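import Mathlib
import Summits.Ventures.PercRepro2.MixChordNarrowed2
import Summits.Ventures.PercRepro2.MixChordSquare

/-!
# The one-edge MONOTONE LAW with a normaliser, the general inductive step, and the crux from the
laws of the root-edge classes (blind cell PercRepro2, night-1 g20; proofs/NIGHT1-G20.md §1–§2)

Along a root edge `e` with `c(q) := Gc (p[e ↦ q])` (a cubic in `q`) write
`Ψ(q) := (c(q) − q · c(1)) / (1 − q)` (a quadratic: the numerator vanishes at `q = 1`; at a
coincidence root edge — far end `o`, `b` or `a₃` — `c(1) = 0` and `Ψ = c/(1 − q)`).  For a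
normaliser `N` (`D`, `D·Z`, `(D·Z)²`, …):

* **`NMixChord N`** (the mixed chord with normaliser `N`, cleared):
  `(1 − p_e) · Gc (p[e ↦ 0]) · N(p) ≤ (Gc p − p_e · Gc (p[e ↦ 1])) · N(p[e ↦ 0])`, i.e.
  `Gc p ≥ p_e · Gc(p[e ↦ 1]) + (1 − p_e) · (N(p)/N(p[e ↦ 0])) · Gc(p[e ↦ 0])` — `N = D·Z` is
  (MIX-CHORD), `N = (D·Z)²` is (MIX²);
* **`NLaw N`** (the MONOTONE LAW): `q ↦ Ψ(q) / N(p[e ↦ q])` is nondecreasing on `[0, 1]`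
  (cleared) — the chord from EVERY starting weight `q₁ ≤ q₂`, not only from `0`;
  `nMixChord_of_nLaw`: the law implies the chord (`q₁ = 0`, `q₂ = p_e`).
  Census (NIGHT1-G20.md §1): along the `o`-class root edges `NLaw D` (the PD-mass alone, the
  strongest of the family) is exact on every instance seen (random n ≤ 8: 359 / 359; the engine's
  atlas n = 5 exhaustively, 1,560 / 1,560 per weight spec; `N = 1` and `N = Z` fail); along the
  `b`-class `NLaw D` fails (2 / 1,560) while `NLaw (D·Z)`, `NLaw (D·Z)²` hold; along the unmarked
  class `NLaw (D·Z)` held on the exhaustive n = 6, m ≤ 7 census (11,568 / 11,568).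
* **`InductiveStep`** / **`Gc_nonneg_of_inductiveStep`** / **`HCov_all_of_inductiveStep_all`**:
  the general one-edge inductive certificate — at every instance with a fractional root edge SOME
  root edge `e` has `Gc(p[e ↦ 1]) ≥ 0 → Gc(p[e ↦ 0]) ≥ 0 → Gc p ≥ 0`; strong induction on the
  number of fractional edges (the shape of `Gc_nonneg_of_mixChord`, with the step abstracted).
* **`Gc_nonneg_of_nMixChord_D`** / **`_DZ`** / **`_DZ2`**: the chord with normaliser `D`, `D·Z`
  or `(D·Z)²` is such a step (`N(p[e ↦ 0]) = 0` forces `Gc p = 0` by the monotonicity of the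
  decreasing events `PD`, `Q` in the weight of `e`).
* **`OClass`**: the root edges whose far end's weight-`1` cluster carries `o`;
  **`step_of_laws`** / **`HCov_all_of_laws`**: the crux from `NLaw D` along the `o`-class root
  edges and `NLaw (D·Z)²` along the root edges of no closed class, no `a₃`-class and no `o`-class
  (the closed classes and the `a₃`-class are theorems: `mixChord_of_remaining`,
  `mixChord_of_a3Class`).

Own code; standard axioms.
-/

namespace Summit.Ventures.PercRepro2

open UnionCluster CovForm

namespace Mix

open scoped Classical

section Step

variable {V : Type*} {E : Type*} [Fintype E] [DecidableEq E] {R : Type*} [Field R]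
  [LinearOrder R] [IsStrictOrderedRing R]

/-- **The general one-edge inductive step** at `p`: some root edge `e` has
`Gc (p[e ↦ 1]) ≥ 0 → Gc (p[e ↦ 0]) ≥ 0 → Gc p ≥ 0` (vacuous when there is no root edge). -/
def InductiveStep (p : E → R) (ends : E → Sym2 V) (o a₁ a₂ a₃ b : V) : Prop :=
  (Chord.rootEdges p ends a₁ a₂).Nonempty → ∃ e ∈ Chord.rootEdges p ends a₁ a₂,
    0 ≤ Gc (Function.update p e 1) ends o a₁ a₂ a₃ b →
      0 ≤ Gc (Function.update p e 0) ends o a₁ a₂ a₃ b → 0 ≤ Gc p ends o a₁ a₂ a₃ b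

/-- **The inductive step on all instances ⟹ `Gc ≥ 0`**: strong induction on the number of
fractional edges. -/
theorem Gc_nonneg_of_inductiveStep (ends : E → Sym2 V) (o a₁ a₂ a₃ b : V)
    (hstep : ∀ q : E → R, IsProbVec q → InductiveStep q ends o a₁ a₂ a₃ b) :
    ∀ (n : ℕ) (p : E → R), IsProbVec p → (Chord.frac p).card = n →
      0 ≤ Gc p ends o a₁ a₂ a₃ b := by
  intro n
  induction n using Nat.strong_induction_on with
  | _ n ih =>
  intro p hp hn
  by_cases h0 : Chord.rootEdges p ends a₁ a₂ = ∅
  · rw [Chord.Gc_eq_zero_of_rootEdges_empty h0]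
  · obtain ⟨e, he, hstep'⟩ := hstep p hp (Finset.nonempty_iff_ne_empty.2 h0)
    have hf := Chord.frac_of_mem_rootEdges he
    have hlt : ((Chord.frac p).erase e).card < n := by
      rw [← hn]
      exact Finset.card_erase_lt_of_mem hf
    have h1 := ih _ hlt _ (hp.update e zero_le_one le_rfl) (by rw [Chord.frac_update_one hf])
    have h2 := ih _ hlt _ (hp.update e le_rfl zero_le_one) (by rw [Chord.frac_update_zero hf])
    exact hstep' h1 h2

/-- (HCOV) at `p` from the inductive step on all admissible weight vectors of the instance. -/
theorem HCov_of_inductiveStep (ends : E → Sym2 V) (o a₁ a₂ a₃ b : V)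
    (hstep : ∀ q : E → R, IsProbVec q → InductiveStep q ends o a₁ a₂ a₃ b) (p : E → R)
    (hp : IsProbVec p) : HCov p ends o a₁ a₂ a₃ b :=
  Gc_nonneg_of_inductiveStep ends o a₁ a₂ a₃ b hstep _ p hp rfl

end Step

section StepAll

variable (R : Type*) [Field R] [LinearOrder R] [IsStrictOrderedRing R]

/-- The inductive step over all finite graphs, admissible weights and markings. -/
def InductiveStep_all : Prop :=
  ∀ (V E : Type) [Fintype V] [DecidableEq V] [Fintype E] [DecidableEq E]
    (ends : E → Sym2 V) (p : E → R), IsProbVec p →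
    ∀ o a₁ a₂ a₃ b : V, a₁ ≠ a₂ → a₁ ≠ a₃ → a₂ ≠ a₃ → o ≠ a₁ → o ≠ a₂ → o ≠ a₃ → o ≠ b →
      b ≠ a₁ → b ≠ a₂ → b ≠ a₃ → InductiveStep p ends o a₁ a₂ a₃ b

/-- **The crux from the general inductive step.** -/
theorem HCov_all_of_inductiveStep_all (h : InductiveStep_all R) : HCov_all R := by
  intro V E _ _ _ _ ends p hp o a₁ a₂ a₃ b h12 h13 h23 ho1 ho2 ho3 hob hb1 hb2 hb3
  exact HCov_of_inductiveStep ends o a₁ a₂ a₃ b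
    (fun q hq => h V E ends q hq o a₁ a₂ a₃ b h12 h13 h23 ho1 ho2 ho3 hob hb1 hb2 hb3) p hp

end StepAll

section Law

variable {V : Type*} {E : Type*} [Fintype E] [DecidableEq E] {R : Type*} [Field R]
  [LinearOrder R] [IsStrictOrderedRing R]

variable (N : (E → R) → R) (p : E → R) (ends : E → Sym2 V) (o a₁ a₂ a₃ b : V) (e : E)

/-- **The mixed chord with normaliser `N`** along `e` (cleared):
`(1 − p_e) · Gc (p[e ↦ 0]) · N(p) ≤ (Gc p − p_e · Gc (p[e ↦ 1])) · N(p[e ↦ 0])`. -/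
def NMixChord : Prop :=
  (1 - p e) * Gc (Function.update p e 0) ends o a₁ a₂ a₃ b * N p ≤
    (Gc p ends o a₁ a₂ a₃ b - p e * Gc (Function.update p e 1) ends o a₁ a₂ a₃ b) *
      N (Function.update p e 0)

/-- **The monotone law with normaliser `N`** along `e`: with
`Ψ(q) := (Gc (p[e ↦ q]) − q · Gc (p[e ↦ 1])) / (1 − q)`, the map `q ↦ Ψ(q) / N(p[e ↦ q])` is
nondecreasing on `[0, 1]` (cleared: `Ψ(q₁) (1 − q₂) N(p[e ↦ q₂]) ≤ Ψ(q₂) (1 − q₁) N(p[e ↦ q₁])`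
with the `(1 − q)` factors cleared as well). -/
def NLaw : Prop :=
  ∀ q₁ q₂ : R, 0 ≤ q₁ → q₁ ≤ q₂ → q₂ ≤ 1 →
    (Gc (Function.update p e q₁) ends o a₁ a₂ a₃ b -
        q₁ * Gc (Function.update p e 1) ends o a₁ a₂ a₃ b) *
      ((1 - q₂) * N (Function.update p e q₂)) ≤
    (Gc (Function.update p e q₂) ends o a₁ a₂ a₃ b -
        q₂ * Gc (Function.update p e 1) ends o a₁ a₂ a₃ b) *
      ((1 - q₁) * N (Function.update p e q₁))

variable {N p ends o a₁ a₂ a₃ b e}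

/-- **The law implies the chord** (`q₁ = 0`, `q₂ = p_e`). -/
theorem nMixChord_of_nLaw (hp : IsProbVec p) (h : NLaw N p ends o a₁ a₂ a₃ b e) :
    NMixChord N p ends o a₁ a₂ a₃ b e := by
  have h0 := h 0 (p e) le_rfl (hp.nonneg e) (hp.le_one e)
  rw [Function.update_eq_self] at h0
  simp only [zero_mul, sub_zero, one_mul] at h0
  unfold NMixChord
  linear_combination h0

/-- **The chord with a normaliser is an inductive step** whenever `N ≥ 0` at `p` and at
`p[e ↦ 0]`, and `N(p[e ↦ 0]) = 0` forces `Gc p = 0`. -/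
theorem Gc_nonneg_of_nMixChord (hp : IsProbVec p) (hm : NMixChord N p ends o a₁ a₂ a₃ b e)
    (hN0 : 0 ≤ N (Function.update p e 0)) (hNp : 0 ≤ N p)
    (hdeg : N (Function.update p e 0) = 0 → Gc p ends o a₁ a₂ a₃ b = 0)
    (h1 : 0 ≤ Gc (Function.update p e 1) ends o a₁ a₂ a₃ b)
    (h0 : 0 ≤ Gc (Function.update p e 0) ends o a₁ a₂ a₃ b) :
    0 ≤ Gc p ends o a₁ a₂ a₃ b := by
  by_cases hz : N (Function.update p e 0) = 0
  · rw [hdeg hz]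
  · have hpos : 0 < N (Function.update p e 0) := lt_of_le_of_ne hN0 (Ne.symm hz)
    unfold NMixChord at hm
    have hq0 := hp.nonneg e
    have hq1 := hp.le_one e
    have hL : 0 ≤ (1 - p e) * Gc (Function.update p e 0) ends o a₁ a₂ a₃ b * N p :=
      mul_nonneg (mul_nonneg (sub_nonneg.2 hq1) h0) hNp
    have hR : 0 ≤ Gc p ends o a₁ a₂ a₃ b - p e * Gc (Function.update p e 1) ends o a₁ a₂ a₃ b := by
      rcases lt_or_ge (Gc p ends o a₁ a₂ a₃ b - p e * Gc (Function.update p e 1) ends o a₁ a₂ a₃ b) 0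
        with hneg | hge
      · have := mul_neg_of_neg_of_pos hneg hpos
        linarith
      · exact hge
    nlinarith [mul_nonneg hq0 h1]

/-- `D = P(PD)`: the normaliser of the `o`-class law. -/
noncomputable def normD (ends : E → Sym2 V) (a₁ a₂ a₃ : V) (p : E → R) : R :=
  prob p (PDEvent ends a₁ a₂ a₃)

/-- `D · Z`: the normaliser of (MIX-CHORD). -/
noncomputable def normDZ (ends : E → Sym2 V) (a₁ a₂ a₃ : V) (p : E → R) : R :=
  prob p (PDEvent ends a₁ a₂ a₃) * prob p (avoidAll ends a₂ {a₁})

/-- `(D · Z)²`: the normaliser of (MIX²). -/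
noncomputable def normDZ2 (ends : E → Sym2 V) (a₁ a₂ a₃ : V) (p : E → R) : R :=
  (prob p (PDEvent ends a₁ a₂ a₃) * prob p (avoidAll ends a₂ {a₁})) ^ 2

/-- `D` and `Z` do not increase when an edge is opened: `D(p) ≤ D(p[e ↦ 0])`, `Z(p) ≤ Z(p[e ↦ 0])`,
hence `D(p[e ↦ 0]) · Z(p[e ↦ 0]) = 0` forces `Gc p = 0`. -/
lemma Gc_eq_zero_of_normDZ_update_zero (hp : IsProbVec p)
    (h : normDZ ends a₁ a₂ a₃ (Function.update p e 0) = 0) : Gc p ends o a₁ a₂ a₃ b = 0 := by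
  have hp0 : IsProbVec (Function.update p e 0) := hp.update e le_rfl zero_le_one
  have hD := EdmRow.prob_le_prob_update_zero_of_isLowerSet hp
    (EdmRow.isLowerSet_PDEvent ends a₁ a₂ a₃) e
  have hZ := EdmRow.prob_le_prob_update_zero_of_isLowerSet hp
    (EdmRow.isLowerSet_avoidAll ends a₁ a₂) e
  have hDn := prob_nonneg hp (PDEvent ends a₁ a₂ a₃)
  have hZn := prob_nonneg hp (avoidAll ends a₂ {a₁})
  have hD0n := prob_nonneg hp0 (PDEvent ends a₁ a₂ a₃)
  have hZ0n := prob_nonneg hp0 (avoidAll ends a₂ {a₁})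
  unfold normDZ at h
  apply Chord.Gc_eq_zero_of_degenerate hp ends o a₁ a₂ a₃ b
  rcases mul_eq_zero.1 h with hD0 | hZ0
  · have : prob p (PDEvent ends a₁ a₂ a₃) = 0 := le_antisymm (hD0 ▸ hD) hDn
    rw [this, zero_mul]
  · have : prob p (avoidAll ends a₂ {a₁}) = 0 := le_antisymm (hZ0 ▸ hZ) hZn
    rw [this, mul_zero]

/-- **The `D`-chord is an inductive step.** -/
theorem Gc_nonneg_of_nMixChord_D (hp : IsProbVec p)
    (hm : NMixChord (normD ends a₁ a₂ a₃) p ends o a₁ a₂ a₃ b e)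
    (h1 : 0 ≤ Gc (Function.update p e 1) ends o a₁ a₂ a₃ b)
    (h0 : 0 ≤ Gc (Function.update p e 0) ends o a₁ a₂ a₃ b) :
    0 ≤ Gc p ends o a₁ a₂ a₃ b := by
  have hp0 : IsProbVec (Function.update p e 0) := hp.update e le_rfl zero_le_one
  refine Gc_nonneg_of_nMixChord hp hm (prob_nonneg hp0 _) (prob_nonneg hp _) (fun hz => ?_) h1 h0
  apply Gc_eq_zero_of_normDZ_update_zero hp
  unfold normDZ
  unfold normD at hz
  rw [hz, zero_mul]

/-- **The `D·Z`-chord ((MIX-CHORD) along `e`) is an inductive step.** -/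
theorem Gc_nonneg_of_nMixChord_DZ (hp : IsProbVec p)
    (hm : NMixChord (normDZ ends a₁ a₂ a₃) p ends o a₁ a₂ a₃ b e)
    (h1 : 0 ≤ Gc (Function.update p e 1) ends o a₁ a₂ a₃ b)
    (h0 : 0 ≤ Gc (Function.update p e 0) ends o a₁ a₂ a₃ b) :
    0 ≤ Gc p ends o a₁ a₂ a₃ b := by
  have hp0 : IsProbVec (Function.update p e 0) := hp.update e le_rfl zero_le_one
  refine Gc_nonneg_of_nMixChord hp hm (mul_nonneg (prob_nonneg hp0 _) (prob_nonneg hp0 _))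
    (mul_nonneg (prob_nonneg hp _) (prob_nonneg hp _))
    (fun hz => Gc_eq_zero_of_normDZ_update_zero hp hz) h1 h0

/-- **The `(D·Z)²`-chord ((MIX²) along `e`) is an inductive step.** -/
theorem Gc_nonneg_of_nMixChord_DZ2 (hp : IsProbVec p)
    (hm : NMixChord (normDZ2 ends a₁ a₂ a₃) p ends o a₁ a₂ a₃ b e)
    (h1 : 0 ≤ Gc (Function.update p e 1) ends o a₁ a₂ a₃ b)
    (h0 : 0 ≤ Gc (Function.update p e 0) ends o a₁ a₂ a₃ b) :
    0 ≤ Gc p ends o a₁ a₂ a₃ b := by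
  refine Gc_nonneg_of_nMixChord hp hm (sq_nonneg _) (sq_nonneg _) (fun hz => ?_) h1 h0
  apply Gc_eq_zero_of_normDZ_update_zero hp
  unfold normDZ
  unfold normDZ2 at hz
  exact pow_eq_zero_iff (two_ne_zero) |>.1 hz

/-- **(MIX-CHORD) along `e` in its original shape is an inductive step.** -/
theorem Gc_nonneg_of_mixChord_edge (hp : IsProbVec p)
    (hm : p e * Gc (Function.update p e 1) ends o a₁ a₂ a₃ b +
      (1 - p e) * (shrink p ends a₁ a₂ a₃ e * Gc (Function.update p e 0) ends o a₁ a₂ a₃ b) ≤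
        Gc p ends o a₁ a₂ a₃ b)
    (h1 : 0 ≤ Gc (Function.update p e 1) ends o a₁ a₂ a₃ b)
    (h0 : 0 ≤ Gc (Function.update p e 0) ends o a₁ a₂ a₃ b) :
    0 ≤ Gc p ends o a₁ a₂ a₃ b :=
  (add_nonneg (mul_nonneg (hp.nonneg e) h1)
    (mul_nonneg (sub_nonneg.2 (hp.le_one e)) (mul_nonneg (shrink_nonneg hp ends a₁ a₂ a₃ e) h0))).trans hm

end Law

section Classes

variable {V : Type*} {E : Type*} [Fintype E] [DecidableEq E] [Fintype V] [DecidableEq V]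
  {R : Type*} [Field R] [LinearOrder R] [IsStrictOrderedRing R]

variable (p : E → R) (ends : E → Sym2 V) (o a₁ a₂ : V) (e : E)

/-- A root edge whose far end's weight-`1` cluster carries `o` (the `o`-coincidence class). -/
def OClass : Prop :=
  ∃ x y, ends e = s(x, y) ∧
    (x ∈ cluster ends (Chord.oneConfig p) a₁ ∨ x ∈ cluster ends (Chord.oneConfig p) a₂) ∧
    o ∈ cluster ends (Chord.oneConfig p) y

variable {p ends o a₁ a₂ e}

/-- **The inductive step at `p` from the laws of the open classes**: `NLaw D` along the `o`-class
root edges and `NLaw (D·Z)²` along the root edges of no closed class, no `a₃`-class and no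
`o`-class; the closed classes and the `a₃`-class are theorems. -/
theorem step_of_laws {a₃ b : V} (hp : IsProbVec p)
    (hO : ∀ e ∈ Chord.rootEdges p ends a₁ a₂, OClass p ends o a₁ a₂ e →
      NLaw (normD ends a₁ a₂ a₃) p ends o a₁ a₂ a₃ b e)
    (hR : ∀ e ∈ Chord.rootEdges p ends a₁ a₂, ¬ ClosedClass p ends a₁ a₂ a₃ e →
      ¬ A3Class p ends a₁ a₂ a₃ e → ¬ OClass p ends o a₁ a₂ e →
      NLaw (normDZ2 ends a₁ a₂ a₃) p ends o a₁ a₂ a₃ b e) :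
    InductiveStep p ends o a₁ a₂ a₃ b := by
  intro hne
  obtain ⟨e, he⟩ := hne
  refine ⟨e, he, fun h1 h0 => ?_⟩
  by_cases hc : ClosedClass p ends a₁ a₂ a₃ e
  · refine Gc_nonneg_of_mixChord_edge hp ?_ h1 h0
    rcases hc with ⟨x, y, hxy, ⟨hx, hy⟩ | ⟨hx, hy⟩ | ⟨hx, hy⟩⟩ | hf | hf
    · exact mixChord_internal p hp (Chord.frac_of_mem_rootEdges he) hx hy hxy o a₁ a₂ a₃ b
    · exact mixChord_internal p hp (Chord.frac_of_mem_rootEdges he) hx hy hxy o a₁ a₂ a₃ b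
    · exact mixChord_bridge p ends hp hx hy hxy o a₃ b
    · exact mixChord_root_edge p ends o b hp hf
    · exact mixChord_root2_edge p ends o b hp hf
  by_cases h3 : A3Class p ends a₁ a₂ a₃ e
  · exact Gc_nonneg_of_mixChord_edge hp (mixChord_of_a3Class hp he h3) h1 h0
  by_cases hO' : OClass p ends o a₁ a₂ e
  · exact Gc_nonneg_of_nMixChord_D hp (nMixChord_of_nLaw hp (hO e he hO')) h1 h0
  · exact Gc_nonneg_of_nMixChord_DZ2 hp (nMixChord_of_nLaw hp (hR e he hc h3 hO')) h1 h0

end Classes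

section ClassesAll

variable (R : Type*) [Field R] [LinearOrder R] [IsStrictOrderedRing R]

/-- **Row (LAW-D-o)**: the monotone `D`-law along every root edge of the `o`-class, on all
instances. -/
def DLawO_all : Prop :=
  ∀ (V E : Type) [Fintype V] [DecidableEq V] [Fintype E] [DecidableEq E]
    (ends : E → Sym2 V) (p : E → R), IsProbVec p →
    ∀ o a₁ a₂ a₃ b : V, a₁ ≠ a₂ → a₁ ≠ a₃ → a₂ ≠ a₃ → o ≠ a₁ → o ≠ a₂ → o ≠ a₃ → o ≠ b →
      b ≠ a₁ → b ≠ a₂ → b ≠ a₃ →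
      ∀ e ∈ Chord.rootEdges p ends a₁ a₂, OClass p ends o a₁ a₂ e →
        NLaw (normD ends a₁ a₂ a₃) p ends o a₁ a₂ a₃ b e

/-- **Row (LAW-DZ²-rest)**: the monotone `(D·Z)²`-law along every root edge of no closed class,
no `a₃`-class and no `o`-class, on all instances. -/
def DZ2LawRest_all : Prop :=
  ∀ (V E : Type) [Fintype V] [DecidableEq V] [Fintype E] [DecidableEq E]
    (ends : E → Sym2 V) (p : E → R), IsProbVec p →
    ∀ o a₁ a₂ a₃ b : V, a₁ ≠ a₂ → a₁ ≠ a₃ → a₂ ≠ a₃ → o ≠ a₁ → o ≠ a₂ → o ≠ a₃ → o ≠ b →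
      b ≠ a₁ → b ≠ a₂ → b ≠ a₃ →
      ∀ e ∈ Chord.rootEdges p ends a₁ a₂, ¬ ClosedClass p ends a₁ a₂ a₃ e →
        ¬ A3Class p ends a₁ a₂ a₃ e → ¬ OClass p ends o a₁ a₂ e →
        NLaw (normDZ2 ends a₁ a₂ a₃) p ends o a₁ a₂ a₃ b e

/-- **The crux from the two laws.** -/
theorem HCov_all_of_laws (h₁ : DLawO_all R) (h₂ : DZ2LawRest_all R) : HCov_all R :=
  HCov_all_of_inductiveStep_all R fun V E _ _ _ _ ends p hp o a₁ a₂ a₃ b h12 h13 h23 ho1 ho2 ho3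
    hob hb1 hb2 hb3 =>
      step_of_laws hp (h₁ V E ends p hp o a₁ a₂ a₃ b h12 h13 h23 ho1 ho2 ho3 hob hb1 hb2 hb3)
        (h₂ V E ends p hp o a₁ a₂ a₃ b h12 h13 h23 ho1 ho2 ho3 hob hb1 hb2 hb3)

end ClassesAll

end Mix

end Summit.Ventures.PercRepro2
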